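import Literature.NumberTheory.Sieve.CoprimeSquarefreeSums
import Literature.NumberTheory.LFunctions.MertensElementary
import Literature.NumberTheory.LFunctions.DirichletConvOneChiSum
import HarnessLib

/-!
# Möbius sums over integers coprime to `q`: `Σ μ(g)/g` and `Σ μ(g)/g · log(y/g)` are `O(q/φ(q))`

Topic `Literature/NumberTheory/Sieve`. Two classical elementary bounds, uniform in the modulus
`q ≥ 1` and the length `y`:

* `abs_sum_coprime_moebius_div_le_two` — `|Σ_{g ≤ Y, (g,q)=1} μ(g)/g| ≤ 2`;
* `abs_sum_coprime_moebius_div_mul_log_le` —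
  `|Σ_{g ≤ y, (g,q)=1} μ(g)/g · log(y/g)| ≤ q/φ(q) + 6 ≤ 7 q/φ(q)`.

Both come from one device: for `F(k) = Σ_{j ≤ k} c(j)`,
`Σ_{g ≤ Y, (g,q)=1} μ(g) F(⌊Y/g⌋) = Σ_{n ≤ Y} (Σ_{de = n, (d,q)=1} μ(d) c(e))`, and the divisor sum
`f_q(n) = Σ_{d ∣ n, (d,q)=1} μ(d)` is the indicator of the integers all of whose prime factors
divide `q` (`coprimeMoebiusDivSum_eq`), so that with `c ≡ 1` one gets a count in `[0, Y]`, and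
with `c(j) = 1/j` the sum `Σ_{n ≤ Y, p ∣ n ⇒ p ∣ q} 1/n ∈ [0, q/φ(q)]`; the harmonic numbers are
`H(k) = log k + γ + O(1/k)` (Mathlib's envelopes of Euler's constant). These are the
one-dimensional inputs of the tree's elementary proof of the Goldston–Yıldırım correlation bound
for Green–Tao's majorant (`GreenTao2008CorrelationBound.lean`): they bound the diagonalising
coefficients of the truncated divisor sum `Λ_R` uniformly (the rôle played by
`Σ_{d ≤ y} μ(d) log(y/d)/d = O(1)` in Graham's and Goldston–Yıldırım's treatments of `Λ_R`).

## References
* H. Halberstam, H.-E. Richert, *Sieve Methods* (1974), Ch. 3 §1 (sums of `μ(d)/d` with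
  coprimality conditions). [folklore]
* S. W. Graham, *An asymptotic estimate related to Selberg's sieve*, J. Number Theory 10 (1978),
  83–94, Lemma 2 (`Σ_{d ≤ y,(d,q)=1} μ(d)/d · log(y/d) ≪ q/φ(q)`). [folklore]
-/

noncomputable section

open Finset Real ArithmeticFunction

open scoped ArithmeticFunction.Moebius ArithmeticFunction.zeta

namespace Literature.NumberTheory.Sieve.CoprimeMoebius

/-! ### The multiplicative functions `μ·𝟙_{(·,q)=1}` and `f_q = (μ·𝟙_{(·,q)=1}) * ζ` -/

/-- `μ_q(d) = μ(d)` if `d ≥ 1` is coprime to `q`, and `0` otherwise (as a real arithmetic function: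
the pointwise product of `μ` and the tree's indicator `SquarefreeSums.copInd q`). [folklore] -/
def muCop (q : ℕ) : ArithmeticFunction ℝ :=
  ((μ : ArithmeticFunction ℤ) : ArithmeticFunction ℝ).pmul (SquarefreeSums.copInd q)

/-- `f_q(n) = Σ_{d ∣ n, (d,q)=1} μ(d)` as an arithmetic function (`μ_q * ζ`). [folklore] -/
def fCop (q : ℕ) : ArithmeticFunction ℝ :=
  muCop q * ((ζ : ArithmeticFunction ℕ) : ArithmeticFunction ℝ)

/-- `μ_q(d) = [ (d,q)=1 ] μ(d)` for `d ≠ 0`. [folklore] -/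
theorem muCop_apply {q d : ℕ} (hd : d ≠ 0) :
    muCop q d = if d.Coprime q then ((μ d : ℤ) : ℝ) else 0 := by
  unfold muCop
  rw [pmul_apply, intCoe_apply, SquarefreeSums.copInd_apply]
  by_cases h : d.Coprime q
  · rw [if_pos ⟨hd, h⟩, if_pos h, mul_one]
  · rw [if_neg (fun h' => h h'.2), if_neg h, mul_zero]

/-- `|μ_q(d)| ≤ 1`. [folklore] -/
theorem abs_muCop_le_one (q d : ℕ) : |muCop q d| ≤ 1 := by
  rcases Nat.eq_zero_or_pos d with rfl | hd
  · simp
  · rw [muCop_apply hd.ne']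
    split_ifs
    · exact_mod_cast abs_moebius_le_one
    · simp

/-- `μ_q` is multiplicative. [folklore] -/
theorem isMultiplicative_muCop (q : ℕ) : (muCop q).IsMultiplicative :=
  isMultiplicative_moebius.intCast.pmul (SquarefreeSums.isMultiplicative_copInd q)

/-- `f_q` is multiplicative. [folklore] -/
theorem isMultiplicative_fCop (q : ℕ) : (fCop q).IsMultiplicative :=
  (isMultiplicative_muCop q).mul isMultiplicative_zeta.natCast

/-- `f_q(n) = Σ_{d ∣ n} μ_q(d)`. [folklore] -/
theorem fCop_apply (q n : ℕ) : fCop q n = ∑ d ∈ n.divisors, muCop q d := by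
  unfold fCop
  rw [coe_mul_zeta_apply]

/-- At a prime power `p^k`, `k ≥ 1`: `f_q(p^k) = [p ∣ q]`. [folklore] -/
theorem fCop_apply_prime_pow {q p k : ℕ} (hp : p.Prime) (hk : k ≠ 0) :
    fCop q (p ^ k) = if p ∣ q then 1 else 0 := by
  rw [fCop_apply, Nat.sum_divisors_prime_pow hp]
  -- the terms `j = 0, 1` and `j ≥ 2`
  have hterm : ∀ j ∈ range (k + 1), muCop q (p ^ j) =
      if j = 0 then 1 else if j = 1 then (if p ∣ q then 0 else -1) else 0 := by
    intro j _
    rw [muCop_apply (pow_ne_zero _ hp.ne_zero)]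
    rcases Nat.eq_zero_or_pos j with rfl | hj
    · simp
    · rw [if_neg hj.ne']
      by_cases hj1 : j = 1
      · subst hj1
        rw [if_pos rfl, pow_one, moebius_apply_prime hp]
        by_cases hpq : p ∣ q
        · have hc : ¬ p.Coprime q := fun h => (Nat.Prime.coprime_iff_not_dvd hp).1 h hpq
          rw [if_neg hc, if_pos hpq]
        · have hc : p.Coprime q := (Nat.Prime.coprime_iff_not_dvd hp).2 hpq
          rw [if_pos hc, if_neg hpq]; norm_num
      · rw [if_neg hj1, moebius_apply_prime_pow hp hj.ne', if_neg hj1]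
        simp
  rw [sum_congr rfl hterm]
  rw [sum_range_succ']
  simp only [Nat.succ_ne_zero, if_false, if_true, Nat.succ.injEq]
  have hk1 : 1 ≤ k := Nat.one_le_iff_ne_zero.2 hk
  rw [sum_range_eq_add_Ico _ hk1]
  simp only [if_true]
  rw [sum_eq_zero (fun j hj => by
    have : j ≠ 0 := by have := (mem_Ico.1 hj).1; omega
    rw [if_neg this])]
  split_ifs <;> norm_num

/-- **`f_q` is an indicator**: for `n ≥ 1`, `f_q(n) = 1` if every prime factor of `n` divides `q`,
and `f_q(n) = 0` otherwise (multiplicativity and `f_q(p^k) = [p ∣ q]`). [folklore] -/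
theorem fCop_eq_indicator {q n : ℕ} (hn : n ≠ 0) :
    fCop q n = if ∀ p ∈ n.primeFactors, p ∣ q then 1 else 0 := by
  rw [(isMultiplicative_fCop q).multiplicative_factorization _ hn, Finsupp.prod,
    Nat.support_factorization]
  rw [← prod_boole]
  refine prod_congr rfl fun p hp => ?_
  have hp' := Nat.prime_of_mem_primeFactors hp
  have hk : n.factorization p ≠ 0 := Finsupp.mem_support_iff.1 (by rwa [Nat.support_factorization])
  exact fCop_apply_prime_pow hp' hk

/-- `0 ≤ f_q(n) ≤ 1`. [folklore] -/
theorem fCop_nonneg_le_one (q n : ℕ) : 0 ≤ fCop q n ∧ fCop q n ≤ 1 := by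
  rcases Nat.eq_zero_or_pos n with rfl | hn
  · simp
  · rw [fCop_eq_indicator hn.ne']
    split_ifs <;> norm_num

/-! ### The swapping device -/

/-- `Σ_{g ≤ Y} μ_q(g) ⌊Y/g⌋ = Σ_{n ≤ Y} f_q(n)`. [folklore] -/
theorem sum_muCop_mul_div_eq (q Y : ℕ) :
    ∑ g ∈ Icc 1 Y, muCop q g * ((Y / g : ℕ) : ℝ) = ∑ n ∈ Icc 1 Y, fCop q n := by
  have h := SquarefreeSums.sum_Icc_sum_divisorsAntidiagonal (fun d _ => muCop q d) Y
  simp only [sum_const, Nat.card_Icc, add_tsub_cancel_right, nsmul_eq_mul] at h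
  rw [show (∑ n ∈ Icc 1 Y, fCop q n) = ∑ n ∈ Icc 1 Y, ∑ x ∈ n.divisorsAntidiagonal, muCop q x.1 from
    sum_congr rfl fun n _ => by rw [fCop_apply, Nat.sum_divisorsAntidiagonal (f := fun d _ => muCop q d)]]
  rw [h]
  exact sum_congr rfl fun g _ => mul_comm _ _

/-- `Σ_{g ≤ Y} μ_q(g)/g · H(⌊Y/g⌋) = Σ_{n ≤ Y} f_q(n)/n` (`H` the harmonic numbers). [folklore] -/
theorem sum_muCop_div_mul_harmonic_eq (q Y : ℕ) :
    ∑ g ∈ Icc 1 Y, muCop q g / g * (harmonic (Y / g) : ℝ) = ∑ n ∈ Icc 1 Y, fCop q n / n := by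
  have h := SquarefreeSums.sum_Icc_sum_divisorsAntidiagonal (fun d e => muCop q d / d * (e : ℝ)⁻¹) Y
  have hR : ∀ g ∈ Icc 1 Y, ∑ e ∈ Icc 1 (Y / g), muCop q g / g * (e : ℝ)⁻¹ =
      muCop q g / g * (harmonic (Y / g) : ℝ) := by
    intro g _
    rw [← mul_sum, harmonic_eq_sum_Icc]
    push_cast
    rfl
  rw [sum_congr rfl hR] at h
  rw [← h]
  refine sum_congr rfl fun n hn => ?_
  have hn1 : 1 ≤ n := (mem_Icc.1 hn).1
  rw [fCop_apply, sum_div, ← Nat.sum_divisorsAntidiagonal (f := fun d _ => muCop q d / n)]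
  refine sum_congr rfl fun x hx => ?_
  obtain ⟨hxn, -⟩ := Nat.mem_divisorsAntidiagonal.1 hx
  have hx1 : (x.1 : ℝ) ≠ 0 := by
    have : x.1 ≠ 0 := fun h0 => by rw [h0, zero_mul] at hxn; omega
    exact_mod_cast this
  have hcast : (n : ℝ) = x.1 * x.2 := by rw [← hxn]; push_cast; ring
  rw [hcast]
  field_simp

/-- `n ↦ 1/n` as a (completely) multiplicative real arithmetic function. [folklore] -/
def invAF : ArithmeticFunction ℝ := ⟨fun n => (n : ℝ)⁻¹, by simp⟩

/-- `invAF n = 1/n`. [folklore] -/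
theorem invAF_apply (n : ℕ) : invAF n = (n : ℝ)⁻¹ := rfl

/-- `1/n` is multiplicative. [folklore] -/
theorem isMultiplicative_invAF : invAF.IsMultiplicative := by
  refine ⟨by simp [invAF_apply], fun {m n} _ => ?_⟩
  simp [invAF_apply, mul_comm]

/-- **`Σ_{n ≤ Y} f_q(n)/n ≤ q/φ(q)`**: the integers all of whose prime factors divide `q` have
`Σ 1/n ≤ ∏_{p ∣ q} (1 - 1/p)⁻¹ = q/φ(q)`. [folklore] -/
theorem sum_fCop_div_le {q : ℕ} (hq : q ≠ 0) (Y : ℕ) :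
    ∑ n ∈ Icc 1 Y, fCop q n / n ≤ (q : ℝ) / q.totient := by
  have hmul : ((fCop q).pmul invAF).IsMultiplicative := (isMultiplicative_fCop q).pmul isMultiplicative_invAF
  have h0 : ∀ n, 0 ≤ (fCop q).pmul invAF n := fun n => by
    rw [pmul_apply, invAF_apply]
    exact mul_nonneg (fCop_nonneg_le_one q n).1 (by positivity)
  have h1 := SquarefreeSums.sum_le_prod_sum_prime_pow hmul h0 Y
  have heq : ∑ n ∈ Icc 1 Y, fCop q n / n = ∑ n ∈ Icc 1 Y, (fCop q).pmul invAF n :=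
    sum_congr rfl fun n _ => by rw [pmul_apply, invAF_apply, div_eq_mul_inv]
  rw [heq]
  refine h1.trans ?_
  -- local factors
  have hloc : ∀ p ∈ Nat.primesBelow (Y + 1), ∑ j ∈ range (Y + 1), (fCop q).pmul invAF (p ^ j) ≤
      if p ∣ q then (1 - (p : ℝ)⁻¹)⁻¹ else 1 := by
    intro p hp
    have hp' : p.Prime := (Nat.mem_primesBelow.1 hp).2
    have hp2 : (2 : ℝ) ≤ p := by exact_mod_cast hp'.two_le
    have hterm : ∀ j ∈ range (Y + 1), (fCop q).pmul invAF (p ^ j) =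
        if j = 0 then 1 else (if p ∣ q then ((p : ℝ)⁻¹) ^ j else 0) := by
      intro j _
      rw [pmul_apply, invAF_apply]
      rcases Nat.eq_zero_or_pos j with rfl | hj
      · simp [(isMultiplicative_fCop q).map_one]
      · rw [if_neg hj.ne', fCop_apply_prime_pow hp' hj.ne']
        push_cast
        split_ifs <;> simp [inv_pow]
    rw [sum_congr rfl hterm, sum_range_succ']
    simp only [Nat.succ_ne_zero, if_false, if_true]
    by_cases hpq : p ∣ q
    · simp only [if_pos hpq]
      have hx0 : (0 : ℝ) ≤ (p : ℝ)⁻¹ := by positivity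
      have hx1 : (p : ℝ)⁻¹ < 1 := inv_lt_one_of_one_lt₀ (by linarith)
      have hg := geom_sum_Ico_le_of_lt_one (m := 0) (n := Y + 1) hx0 hx1
      rw [pow_zero, ← range_eq_Ico, sum_range_succ', pow_zero, one_div] at hg
      exact hg
    · simp [hpq]
  calc ∏ p ∈ Nat.primesBelow (Y + 1), ∑ j ∈ range (Y + 1), (fCop q).pmul invAF (p ^ j)
      ≤ ∏ p ∈ Nat.primesBelow (Y + 1), (if p ∣ q then (1 - (p : ℝ)⁻¹)⁻¹ else 1) :=
        prod_le_prod (fun p _ => sum_nonneg fun j _ => h0 _) hloc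
    _ = ∏ p ∈ (Nat.primesBelow (Y + 1)).filter (· ∣ q), (1 - (p : ℝ)⁻¹)⁻¹ := by
        rw [prod_filter]
    _ ≤ ∏ p ∈ q.primeFactors, (1 - (p : ℝ)⁻¹)⁻¹ := by
        have hfac : ∀ p : ℕ, p.Prime → (0 : ℝ) < 1 - (p : ℝ)⁻¹ ∧ 1 - (p : ℝ)⁻¹ ≤ 1 := by
          intro p hp
          have hp2 : (2 : ℝ) ≤ p := by exact_mod_cast hp.two_le
          have hinv : (p : ℝ)⁻¹ ≤ 2⁻¹ := by
            rw [inv_le_inv₀ (by linarith) (by norm_num)]; exact hp2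
          have h0 : (0 : ℝ) ≤ (p : ℝ)⁻¹ := by positivity
          constructor
          · norm_num at hinv ⊢; linarith
          · linarith
        refine prod_le_prod_of_subset_of_one_le (fun p hp => ?_) (fun p hp => ?_)
          (fun p hp _ => ?_)
        · obtain ⟨hp1, hp2⟩ := mem_filter.1 hp
          exact Nat.mem_primeFactors.2 ⟨(Nat.mem_primesBelow.1 hp1).2, hp2, hq⟩
        · exact inv_nonneg.2 (hfac p (Nat.mem_primesBelow.1 (mem_filter.1 hp).1).2).1.le
        · have h := hfac p (Nat.prime_of_mem_primeFactors hp)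
          calc (1 : ℝ) = 1⁻¹ := inv_one.symm
            _ ≤ (1 - (p : ℝ)⁻¹)⁻¹ := inv_anti₀ h.1 h.2
    _ = (q : ℝ) / q.totient := by
        rw [Literature.NumberTheory.LFunctions.MertensBound.totient_eq_mul_prod_one_sub_inv q,
          prod_inv_distrib]
        have hq0 : (q : ℝ) ≠ 0 := by exact_mod_cast hq
        rw [← div_div, div_self hq0, one_div]
        simp only [one_div]

/-! ### `|Σ_{g ≤ Y, (g,q)=1} μ(g)/g| ≤ 2` -/

/-- The coprime Möbius sum in terms of `μ_q`. [folklore] -/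
theorem sum_filter_coprime_moebius_div_eq (q Y : ℕ) :
    ∑ g ∈ (Icc 1 Y).filter (fun g => g.Coprime q), ((μ g : ℤ) : ℝ) / g =
      ∑ g ∈ Icc 1 Y, muCop q g / g := by
  rw [sum_filter]
  refine sum_congr rfl fun g hg => ?_
  have hg1 : g ≠ 0 := by have := (mem_Icc.1 hg).1; omega
  rw [muCop_apply hg1]
  split_ifs <;> simp

/-- **Uniform bound for the coprime Möbius sum**: `|Σ_{g ≤ Y, (g,q)=1} μ(g)/g| ≤ 2` for all `q`
and `Y` (from `Y · Σ = Σ_{n ≤ Y} f_q(n) + Σ_g μ_q(g){Y/g}`, both at most `Y` in size).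
[folklore] -/
theorem abs_sum_coprime_moebius_div_le_two (q Y : ℕ) :
    |∑ g ∈ (Icc 1 Y).filter (fun g => g.Coprime q), ((μ g : ℤ) : ℝ) / g| ≤ 2 := by
  rw [sum_filter_coprime_moebius_div_eq]
  rcases Nat.eq_zero_or_pos Y with rfl | hY
  · simp
  have hY0 : (0 : ℝ) < Y := by exact_mod_cast hY
  set M := ∑ g ∈ Icc 1 Y, muCop q g / g with hM
  set T := ∑ g ∈ Icc 1 Y, muCop q g * ((Y / g : ℕ) : ℝ) with hT
  -- `0 ≤ T ≤ Y`
  have hT0 : 0 ≤ T ∧ T ≤ Y := by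
    rw [hT, sum_muCop_mul_div_eq]
    constructor
    · exact sum_nonneg fun n _ => (fCop_nonneg_le_one q n).1
    · calc ∑ n ∈ Icc 1 Y, fCop q n ≤ ∑ _n ∈ Icc 1 Y, (1 : ℝ) :=
            sum_le_sum fun n _ => (fCop_nonneg_le_one q n).2
        _ = Y := by simp
  -- `|Y M - T| ≤ Y`
  have hdiff : |(Y : ℝ) * M - T| ≤ Y := by
    rw [hM, hT, mul_sum, ← sum_sub_distrib]
    have hterm : ∀ g ∈ Icc 1 Y, |(Y : ℝ) * (muCop q g / g) - muCop q g * ((Y / g : ℕ) : ℝ)| ≤ 1 := by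
      intro g hg
      have hg1 : (1 : ℝ) ≤ g := by exact_mod_cast (mem_Icc.1 hg).1
      have hg0 : (0 : ℝ) < g := by linarith
      have hfrac0 : ((Y / g : ℕ) : ℝ) ≤ (Y : ℝ) / g := Nat.cast_div_le
      have hfrac1 : (Y : ℝ) / g < ((Y / g : ℕ) : ℝ) + 1 := by
        have h := Nat.lt_div_mul_add (a := Y) (b := g) (by exact_mod_cast hg0)
        have h' : (Y : ℝ) < ((Y / g : ℕ) : ℝ) * g + g := by exact_mod_cast h
        rw [div_lt_iff₀ hg0]
        linarith
      have heq : (Y : ℝ) * (muCop q g / g) - muCop q g * ((Y / g : ℕ) : ℝ) =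
          muCop q g * ((Y : ℝ) / g - ((Y / g : ℕ) : ℝ)) := by ring
      rw [heq, abs_mul]
      have h1 := abs_muCop_le_one q g
      have h2 : |(Y : ℝ) / g - ((Y / g : ℕ) : ℝ)| ≤ 1 := by
        rw [abs_le]; constructor <;> linarith
      calc |muCop q g| * |(Y : ℝ) / g - ((Y / g : ℕ) : ℝ)| ≤ 1 * 1 :=
            mul_le_mul h1 h2 (abs_nonneg _) zero_le_one
        _ = 1 := one_mul _
    calc |∑ g ∈ Icc 1 Y, ((Y : ℝ) * (muCop q g / g) - muCop q g * ((Y / g : ℕ) : ℝ))|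
        ≤ ∑ g ∈ Icc 1 Y, |(Y : ℝ) * (muCop q g / g) - muCop q g * ((Y / g : ℕ) : ℝ)| :=
          abs_sum_le_sum_abs _ _
      _ ≤ ∑ _g ∈ Icc 1 Y, (1 : ℝ) := sum_le_sum hterm
      _ = Y := by simp
  have hYM : |(Y : ℝ) * M| ≤ 2 * Y := by
    have := abs_sub_abs_le_abs_sub ((Y : ℝ) * M) T
    rw [abs_of_nonneg hT0.1] at this
    linarith [hT0.2]
  rw [abs_mul, abs_of_pos hY0] at hYM
  nlinarith

/-! ### Harmonic numbers against `log + γ` at a real argument -/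

/-- For real `t ≥ 1`: `|H(⌊t⌋) − (log t + γ)| ≤ 4/t` (the tree's `|H(k) − log k − γ| ≤ 1/k`,
`Literature.NumberTheory.LFunctions.DirichletAbel.abs_harmonic_sub_log_sub_eulerMascheroni_le`, with
`0 ≤ log t − log k ≤ 1/k` and `k = ⌊t⌋ ≥ t/2`). [folklore] -/
theorem abs_harmonic_floor_sub_log_sub_const_le {t : ℝ} (ht : 1 ≤ t) :
    |(harmonic ⌊t⌋₊ : ℝ) - (Real.log t + Real.eulerMascheroniConstant)| ≤ 4 / t := by
  set k : ℕ := ⌊t⌋₊ with hk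
  have hk1 : 1 ≤ k := by rw [hk]; exact Nat.le_floor (by exact_mod_cast ht)
  have hk0 : (0 : ℝ) < k := by exact_mod_cast hk1
  have ht0 : 0 < t := by linarith
  have hkt : (k : ℝ) ≤ t := Nat.floor_le ht0.le
  have htk : t < k + 1 := Nat.lt_floor_add_one t
  have hH := Literature.NumberTheory.LFunctions.DirichletAbel.abs_harmonic_sub_log_sub_eulerMascheroni_le hk1
  -- `0 ≤ log t - log k ≤ 1/k`
  have hl0 : Real.log k ≤ Real.log t := Real.log_le_log hk0 hkt
  have hl1 : Real.log t - Real.log k ≤ 1 / (k : ℝ) := by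
    have h1 : Real.log t ≤ Real.log ((k : ℝ) + 1) := Real.log_le_log ht0 htk.le
    have h2 : Real.log ((k : ℝ) + 1) - Real.log k ≤ 1 / (k : ℝ) := by
      rw [← Real.log_div (by positivity) hk0.ne']
      have := Real.log_le_sub_one_of_pos (x := ((k : ℝ) + 1) / k) (by positivity)
      rw [div_sub_one hk0.ne', add_sub_cancel_left] at this
      exact this
    linarith
  -- `2/k ≤ 4/t`
  have hkt2 : t ≤ 2 * k := by
    by_cases h2 : t < 2
    · have : (1 : ℝ) ≤ k := by exact_mod_cast hk1
      linarith
    · push Not at h2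
      linarith
  have hfin : 2 / (k : ℝ) ≤ 4 / t := by
    rw [div_le_div_iff₀ hk0 ht0]; linarith
  rw [abs_le] at hH ⊢
  obtain ⟨hH1, hH2⟩ := hH
  constructor
  · have : -(4 / t) ≤ -(2 / (k : ℝ)) := by linarith
    have h2k : (2 : ℝ) / k = 1 / k + 1 / k := by ring
    linarith
  · have h2k : (2 : ℝ) / k = 1 / k + 1 / k := by ring
    linarith

/-! ### `|Σ_{g ≤ y, (g,q)=1} μ(g)/g · log(y/g)| ≤ q/φ(q) + 6` -/

/-- **The logarithmically weighted coprime Möbius sum is `O(q/φ(q))` uniformly**: for `q ≥ 1` and every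
real `y`, `|Σ_{g ≤ y, (g,q)=1} μ(g)/g · log(y/g)| ≤ q/φ(q) + 6`. Proof: with `H` the harmonic numbers,
`Σ_g μ_q(g)/g · H(⌊y/g⌋) = Σ_{n ≤ y} f_q(n)/n ∈ [0, q/φ(q)]`; `H(⌊y/g⌋) = log(y/g) + γ + O(g/y)` with
`|O(g/y)| ≤ 4g/y`, the `γ`-term is `γ Σ_g μ_q(g)/g`, at most `2γ < 2` in size, and the error terms add
up to at most `4 ⌊y⌋/y ≤ 4`. (Graham, J. Number Theory 10 (1978), Lemma 2, has `≪ q/φ(q)`; the crude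
explicit constant is all that is used downstream.) [folklore] -/
theorem abs_sum_coprime_moebius_div_mul_log_le {q : ℕ} (hq : q ≠ 0) (y : ℝ) :
    |∑ g ∈ (Icc 1 ⌊y⌋₊).filter (fun g => g.Coprime q), ((μ g : ℤ) : ℝ) / g * Real.log (y / g)| ≤
      (q : ℝ) / q.totient + 6 := by
  have hφ0 : 0 ≤ (q : ℝ) / q.totient := by positivity
  by_cases hy : y < 1
  · have : ⌊y⌋₊ = 0 := Nat.floor_eq_zero.2 hy
    rw [this]
    simp only [show Icc 1 0 = (∅ : Finset ℕ) by rfl, filter_empty, sum_empty, abs_zero]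
    linarith
  push Not at hy
  have hy0 : 0 < y := by linarith
  set Y : ℕ := ⌊y⌋₊ with hY
  have hY1 : 1 ≤ Y := Nat.le_floor (by exact_mod_cast hy)
  have hYy : (Y : ℝ) ≤ y := Nat.floor_le hy0.le
  -- rewrite with `μ_q`
  have hA : ∑ g ∈ (Icc 1 Y).filter (fun g => g.Coprime q), ((μ g : ℤ) : ℝ) / g * Real.log (y / g) =
      ∑ g ∈ Icc 1 Y, muCop q g / g * Real.log (y / g) := by
    rw [sum_filter]
    refine sum_congr rfl fun g hg => ?_
    have hg1 : g ≠ 0 := by have := (mem_Icc.1 hg).1; omega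
    rw [muCop_apply hg1]
    split_ifs <;> simp
  rw [hA]
  set A := ∑ g ∈ Icc 1 Y, muCop q g / g * Real.log (y / g) with hAdef
  set S := ∑ g ∈ Icc 1 Y, muCop q g / g * (harmonic (Y / g) : ℝ) with hSdef
  set M := ∑ g ∈ Icc 1 Y, muCop q g / g with hMdef
  set γ := Real.eulerMascheroniConstant with hγ
  -- `0 ≤ S ≤ q/φ(q)`
  have hS : 0 ≤ S ∧ S ≤ (q : ℝ) / q.totient := by
    rw [hSdef, sum_muCop_div_mul_harmonic_eq]
    exact ⟨sum_nonneg fun n _ => div_nonneg (fCop_nonneg_le_one q n).1 (Nat.cast_nonneg _),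
      sum_fCop_div_le hq Y⟩
  -- `|M| ≤ 2`
  have hM : |M| ≤ 2 := by
    rw [hMdef, ← sum_filter_coprime_moebius_div_eq]
    exact abs_sum_coprime_moebius_div_le_two q Y
  -- the error terms
  have hE : |S - A - γ * M| ≤ 4 := by
    rw [hSdef, hAdef, hMdef, mul_sum, ← sum_sub_distrib, ← sum_sub_distrib]
    have hterm : ∀ g ∈ Icc 1 Y, |muCop q g / g * (harmonic (Y / g) : ℝ) - muCop q g / g * Real.log (y / g) -
        γ * (muCop q g / g)| ≤ 4 / y := by
      intro g hg
      obtain ⟨hg1, hgY⟩ := mem_Icc.1 hg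
      have hg0 : (0 : ℝ) < g := by exact_mod_cast hg1
      have hyg : 1 ≤ y / g := by
        rw [le_div_iff₀ hg0, one_mul]
        exact le_trans (by exact_mod_cast hgY) hYy
      have hfl : ⌊y / g⌋₊ = Y / g := by rw [hY]; exact Nat.floor_div_natCast y g
      have hh := abs_harmonic_floor_sub_log_sub_const_le hyg
      rw [hfl] at hh
      have heq : muCop q g / g * (harmonic (Y / g) : ℝ) - muCop q g / g * Real.log (y / g) -
          γ * (muCop q g / g) = muCop q g / g * ((harmonic (Y / g) : ℝ) - (Real.log (y / g) + γ)) := by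
        ring
      rw [heq, abs_mul, abs_div, Nat.abs_cast]
      have h1 : |muCop q g| / g ≤ 1 / g := div_le_div_of_nonneg_right (abs_muCop_le_one q g) hg0.le
      calc |muCop q g| / g * |(harmonic (Y / g) : ℝ) - (Real.log (y / g) + γ)|
          ≤ (1 / g) * (4 / (y / g)) := mul_le_mul h1 hh (abs_nonneg _) (by positivity)
        _ = 4 / y := by field_simp
    calc |∑ g ∈ Icc 1 Y, (muCop q g / g * (harmonic (Y / g) : ℝ) - muCop q g / g * Real.log (y / g) -
          γ * (muCop q g / g))|
        ≤ ∑ g ∈ Icc 1 Y, |muCop q g / g * (harmonic (Y / g) : ℝ) - muCop q g / g * Real.log (y / g) -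
          γ * (muCop q g / g)| := abs_sum_le_sum_abs _ _
      _ ≤ ∑ _g ∈ Icc 1 Y, 4 / y := sum_le_sum hterm
      _ = Y * (4 / y) := by simp
      _ ≤ y * (4 / y) := by gcongr
      _ = 4 := by field_simp
  -- assemble
  have hγ0 : 0 < γ := lt_trans (by norm_num) Real.one_half_lt_eulerMascheroniConstant
  have hγ1 : γ < 2 / 3 := Real.eulerMascheroniConstant_lt_two_thirds
  have hAeq : A = S - γ * M - (S - A - γ * M) := by ring
  rw [hAeq]
  have hγM : |γ * M| ≤ 2 / 3 * 2 := by
    rw [abs_mul, abs_of_pos hγ0]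
    exact mul_le_mul hγ1.le hM (abs_nonneg _) (by norm_num)
  calc |S - γ * M - (S - A - γ * M)| ≤ |S - γ * M| + |S - A - γ * M| := abs_sub _ _
    _ ≤ (|S| + |γ * M|) + 4 := add_le_add (abs_sub _ _) hE
    _ ≤ ((q : ℝ) / q.totient + 2 / 3 * 2) + 4 := by
        gcongr
        rw [abs_of_nonneg hS.1]; exact hS.2
    _ ≤ (q : ℝ) / q.totient + 6 := by linarith

/-- The form used downstream: `|Σ_{g ≤ y, (g,q)=1} μ(g)/g · log(y/g)| ≤ 7 q/φ(q)` (`q/φ(q) ≥ 1`).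
[folklore] -/
theorem abs_sum_coprime_moebius_div_mul_log_le' {q : ℕ} (hq : q ≠ 0) (y : ℝ) :
    |∑ g ∈ (Icc 1 ⌊y⌋₊).filter (fun g => g.Coprime q), ((μ g : ℤ) : ℝ) / g * Real.log (y / g)| ≤
      7 * ((q : ℝ) / q.totient) := by
  have h := abs_sum_coprime_moebius_div_mul_log_le hq y
  have h1 : 1 ≤ (q : ℝ) / q.totient := by
    rw [le_div_iff₀ (by exact_mod_cast Nat.totient_pos.2 (Nat.pos_of_ne_zero hq)), one_mul]
    exact_mod_cast Nat.totient_le q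
  linarith

end Literature.NumberTheory.Sieve.CoprimeMoebius
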